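import Summits.HodgeConjecture.HodgeConjecture.Theorems.Ring2AbelianAllAndreNondegenerateInverse
import Summits.HodgeConjecture.HodgeConjecture.Theorems.Ring2AbelianAllAndreSquarePencilEndomorphisms
import Literature.AlgebraicGeometry.HodgeTheory.PulledBackAlgebraicClasses
import HarnessLib

/-!
# Ring 2 · sub-cell AbelianAll (ALL ABELIAN VARIETIES), André axis, part XLI-d — A BLOCK PATTERN OF FIBRE TRACES SUFFICES: with the
# intertwiners a pencil already owns (polynomials in an `S`-endomorphism), β holds as soon as algebraic correspondences `M_i` have fibre
# traces with INJECTIVE `(i, π i)`-BLOCKS for one permutation `π` of the pieces of the invariants — for W₆: non-zero ENTRIES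

HONEST FRAMING (page 1, verbatim): **research route, not a corollary; conditional on HC_CM plus one named
minimal statement.** Cell line: research route conditional on HC_CM; not a corollary; Q11.4-sentence-2
already refuted in dim ≥ 3. Nothing in this file proves a case of the Hodge conjecture for an abelian variety, nor `B(X)` for a new `X`;
`HC_CM` (`Theses.RankFourFaces.CMAbelianHodge`) does not occur in this file; item `Theses.RankFourFaces.CMToAbelian` (stmt-16267)
OPEN and not closed here. Seat `pub-hodge-ring2-ab-andre-2`, gen 33; brief (iii) "state the smallest open instance as a find-the-cycle
problem".

Part XLI-a: β at `t` in degree `k` ⟺ SOME algebraic `M : H^{k+2}(𝒳) → Hᵏ(𝒳)` has fibre trace `v_M = j_t^* M j_{t*}` injective on the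
invariants `I = j_t^* Hᵏ(𝒳)`. THIS FILE lowers the bar once more, using correspondences the pencil already owns. Suppose algebraic
endomorphisms `G_i` of `Hᵏ(𝒳)` and `G'_i` of `H^{k+2}(𝒳)` INTERTWINE fibre operators `E_i` (`j_t^* G_i = E_i j_t^*`, `G'_i j_{t*} = j_{t*} E_i`)
which split the invariants (`E_i E_j = 0` for `i ≠ j` and `Σ_i E_i = 𝟙` on `I`) — for an `S`-endomorphism `φ` of the pencil every polynomial
in `φ^*` does this with `E_i` the same polynomial in `φ_t^*` (§2: functoriality and part XXXVII-b's exact base change `φ^* j_{t*} = j_{t*} φ_t^*`).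
Then the fibre trace of `G_i ∘ M ∘ G'_j` is the BLOCK `E_i v_M E_j`, so fibre traces of algebraic correspondences form a bimodule over
the `E`'s, and (§1, linear algebra) a sum of blocks `Σ_i E_i v_{M_i} E_{π i}` along a PERMUTATION `π` with each block injective on
`E_{π i} I` is injective on `I`. Hence (**`exists_betaInverse_of_blockPattern`**) β holds as soon as, for one permutation `π` of the
pieces, algebraic `M_i` exist whose `(i, π i)`-blocks are injective — for pieces that are LINES: non-zero. READING (W₆; hypotheses
print-true there, not formalised): `I_t⁶ = ℂθ³ ⊕ W_σ ⊕ W_σ̄`, the three eigenlines of the imaginary-quadratic action `(N + ι)^*`, split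
by Lagrange polynomials in the GLOBAL action; the `(θ,θ)` entry is supplied by the algebraic rank-one correspondence `K³ ⊗ K³` (part
XLI-c); so `B⋆(𝒳) ∀η` holds as soon as algebraic cycles on the 14-fold `𝒳 × 𝒳` have fibre traces with non-zero `(σ,σ)` and `(σ̄,σ̄)`
entries, or non-zero `(σ,σ̄)` and `(σ̄,σ)` entries — and for a cycle with REAL (e.g. rational) class the two entries of either pair are
complex conjugates of each other, so ONE NON-ZERO ENTRY OF THE WEIL BLOCK OF ONE ALGEBRAIC CYCLE suffices (conjugation: prose only).
Equivalently: the open instance fails only if the Weil plane of a fibre, pushed into `H⁸(𝒳)`, is carried by EVERY algebraic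
self-correspondence of `𝒳` of degree `−2` into `ℂθ³ ⊕ ker j_{t*}`.

## What is proved (theorems only; no definition, no named fact, no sorry; standard axioms)

§1 **`injOn_of_blockPattern`** (linear algebra). §2 intertwiners: **`fibreTrace_conj_eq_block`** (`j^*(G M G')j_* = E v_M E'`),
**`map_fiberι_polynomial_map`**, **`polynomial_map_fiberGysin`** (polynomials in `φ^*` intertwine the same polynomials in `φ_t^*`: through
`j_t^*` by functoriality, through `j_{t*}` by exact base change), **`isAlgebraicCorrespondence_polynomial_map_total`**. §3 **`exists_betaInverse_of_blockPattern`**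
(abstract intertwiners), **`exists_betaInverse_of_blockPattern_of_endo`** (intertwiners = polynomials in an `S`-endomorphism), and the converse
remark **`blockPattern_of_betaInverse`** (an exact inverse has the identity pattern).

HONEST STATUS. PRINT: the bimodule remark is elementary; [Kleiman1968AlgebraicCycles, App. to §2, 2A11] (Cayley–Hamilton transfer) and
[Fulton1998, Thm. 6.2 (a), §16.1] (base change, composition) are the inputs; the W₆ reading uses the standard decomposition of `H⁶` of a Weil-type
sixfold under its imaginary-quadratic field [vanGeemen1994HodgeAV, Lemma 5.2 (6) / (5.4.1)] as hypotheses. LEAN: fact-free. GAP: none closed;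
finding one such cycle IS the open problem; N104 untouched.
References: Kleiman1968AlgebraicCycles (2A11); Fulton1998 (§6.2, §16.1); FultonYoungTableaux1997 (App. B); Andre1996Motifs (§5.1, §6.3 Rem. 2);
Tankeev2003 (Thm. 10.1, 11.6); vanGeemen1994HodgeAV (Lemma 5.2 (6), (5.4.1)); DeligneHodgeII1971 (4.1.1).
-/

noncomputable section

set_option linter.dupNamespace false

namespace Summit.HodgeConjecture.HodgeConjecture.Ring2.AbelianAll

open CategoryTheory CategoryTheory.Limits AlgebraicGeometry
open Literature.AlgebraicGeometry Literature.AlgebraicGeometry.Motives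
open Literature.AlgebraicGeometry.HodgeTheory
open Literature.AlgebraicTopology.SingularHomology (singularCohomology)
open Summit.HodgeConjecture.HodgeConjecture.Theorems (deg_fiberGysin_aux)

/-! ## §1 Linear algebra: a permutation pattern of injective blocks is injective -/

section LinearAlgebra

variable {V : Type*} [AddCommGroup V] [Module ℂ V] {ι : Type*} [Fintype ι] [DecidableEq ι]

omit [DecidableEq ι] in
/-- **A PERMUTATION PATTERN OF INJECTIVE BLOCKS IS INJECTIVE.** Let `E_i` (`i ∈ ι`) be endomorphisms which on a subspace `I` are pairwise
orthogonal (`E_i E_j x = 0`, `i ≠ j`) and complete (`Σ_i E_i x = x`); let `π : ι → ι` be surjective and `w_i` endomorphisms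
with values in `I` such that each block `E_i w_i E_{π i}` is injective on `E_{π i} I` (`E_i (w_i (E_{π i} x)) = 0 ⟹ E_{π i} x = 0` for `x ∈ I`). Then
`v' = Σ_i E_i w_i E_{π i}` is injective on `I`: `E_i v' x = E_i w_i E_{π i} x` (orthogonality + idempotence on `I`), so `v' x = 0` kills every
`E_{π i} x`, i.e. every `E_j x`, i.e. `x`. [folklore] -/
theorem injOn_of_blockPattern (I : Submodule ℂ V) (E : ι → V →ₗ[ℂ] V)
    (horth : ∀ i j, i ≠ j → ∀ x ∈ I, E i (E j x) = 0) (hsum : ∀ x ∈ I, ∑ i, E i x = x)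
    (π : ι → ι) (hπ : Function.Surjective π) (w : ι → V →ₗ[ℂ] V) (hwI : ∀ i x, w i x ∈ I)
    (hinj : ∀ i, ∀ x ∈ I, E i (w i (E (π i) x)) = 0 → E (π i) x = 0)
    (x : V) (hx : x ∈ I) (h0 : ∑ i, E i (w i (E (π i) x)) = 0) : x = 0 := by
  -- idempotence on `I`
  have hidem : ∀ i, ∀ y ∈ I, E i (E i y) = E i y := fun i y hy ↦ by
    have h := congrArg (E i) (hsum y hy)
    rw [map_sum, Finset.sum_eq_single i (fun j _ hj ↦ horth i j (Ne.symm hj) y hy) (fun hi ↦ absurd (Finset.mem_univ i) hi)] at h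
    exact h
  -- each block vanishes
  have hblock : ∀ i, E i (w i (E (π i) x)) = 0 := fun i ↦ by
    have h := congrArg (E i) h0
    rw [map_sum, map_zero] at h
    rw [Finset.sum_eq_single i (fun j _ hj ↦ horth i j (Ne.symm hj) _ (hwI j _)) (fun hi ↦ absurd (Finset.mem_univ i) hi)] at h
    rw [hidem i _ (hwI i _)] at h
    exact h
  have hE : ∀ j, E j x = 0 := fun j ↦ by
    obtain ⟨i, rfl⟩ := hπ j
    exact hinj i x hx (hblock i)
  rw [← hsum x hx]
  exact Finset.sum_eq_zero fun j _ ↦ hE j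

end LinearAlgebra

variable {𝒳 S : SchemeOver ℂ} {d : ℕ} {f : 𝒳 ⟶ S} (hf : IsCompactAbelianPencil f d)

/-- `𝐆[hf, s, k]` — `j_{s*} : Hᵏ(X_s(ℂ); ℂ) → H^{k+2}(𝒳(ℂ); ℂ)` for the complex orientations (display notation, as in part XL-a).
[cite: FultonYoungTableaux1997, Appendix B §B.1 (5)] -/
local notation3 (prettyPrint := false) "𝐆[" hf ", " s ", " k "]" =>
  complexGysin complexOrientationFamily (IsCompactAbelianPencil.isSmoothProjective_fiberOver hf s)
    (IsCompactAbelianPencil.isSmoothProjective_total hf) (fiberι f s) (deg_fiberGysin_aux k d)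

/-- `𝐣[s, k]` — `j_s^* : Hᵏ(𝒳(ℂ); ℂ) → Hᵏ(X_s(ℂ); ℂ)` as a linear map (display notation). [cite: VoisinHodgeI2002, §7.3.2] -/
local notation3 (prettyPrint := false) "𝐣[" s ", " k "]" => (complexBetti.map (fiberι f s) k).hom

/-! ## §2 Intertwiners: fibre traces of conjugated correspondences are blocks; polynomials in an `S`-endomorphism intertwine -/

section Intertwiners

/-- **The fibre trace of `G ∘ M ∘ G'` is the block `E ∘ v_M ∘ E'`** when `j_t^* G = E j_t^*` and `G' j_{t*} = j_{t*} E'`. [folklore]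
[cite: Fulton1998, §16.1 Prop. 16.1.1] -/
theorem fibreTrace_conj_eq_block (t : ComplexPoints S) {k : ℕ} (M : complexBetti 𝒳 (k + 2) →ₗ[ℂ] complexBetti 𝒳 k)
    (G : complexBetti 𝒳 k →ₗ[ℂ] complexBetti 𝒳 k) (G' : complexBetti 𝒳 (k + 2) →ₗ[ℂ] complexBetti 𝒳 (k + 2))
    (E E' : complexBetti (fiberOver f t) k →ₗ[ℂ] complexBetti (fiberOver f t) k)
    (hG : ∀ W, 𝐣[t, k] (G W) = E (𝐣[t, k] W)) (hG' : ∀ x, G' (𝐆[hf, t, k] x) = 𝐆[hf, t, k] (E' x)) (x : complexBetti (fiberOver f t) k) :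
    𝐣[t, k] ((G ∘ₗ M ∘ₗ G') (𝐆[hf, t, k] x)) = E (𝐣[t, k] (M (𝐆[hf, t, k] (E' x)))) := by
  simp only [LinearMap.comp_apply, hG', hG]

/-- **`j_t^* ∘ P(φ^*) = P(φ_t^*) ∘ j_t^*`** for an endomorphism `φ` of `𝒳` restricting to `φ_t` on `X_t` (`φ_t ≫ j_t = j_t ≫ φ`): functoriality.
[cite: FultonYoungTableaux1997, Appendix B §B.1 (1)] -/
theorem map_fiberι_polynomial_map (t : ComplexPoints S) {k : ℕ} (φ : 𝒳 ⟶ 𝒳) (φt : fiberOver f t ⟶ fiberOver f t)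
    (hφt : φt ≫ fiberι f t = fiberι f t ≫ φ) (s : Finset ℕ) (c : ℕ → ℂ) (W : complexBetti 𝒳 k) :
    𝐣[t, k] ((∑ m ∈ s, c m • (complexBetti.map φ k).hom ^ m) W) = (∑ m ∈ s, c m • (complexBetti.map φt k).hom ^ m) (𝐣[t, k] W) := by
  have hpow : ∀ m : ℕ, 𝐣[t, k] (((complexBetti.map φ k).hom ^ m) W) = ((complexBetti.map φt k).hom ^ m) (𝐣[t, k] W) := by
    intro m
    induction m generalizing W with
    | zero => simp only [pow_zero, Module.End.one_apply]
    | succ m ih =>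
      rw [pow_succ, pow_succ, Module.End.mul_apply, Module.End.mul_apply, ih]
      congr 1
      rw [← complexBetti.map_comp_apply, ← complexBetti.map_comp_apply, hφt]
  simp only [LinearMap.sum_apply, LinearMap.smul_apply, map_sum, map_smul, hpow]

/-- **`P(φ^*) ∘ j_{t*} = j_{t*} ∘ P(φ_t^*)`** for an `S`-endomorphism `φ` of a compact abelian pencil (part XXXVII-b's exact base change
`φ^* j_{t*} = j_{t*} φ_t^*`, iterated and summed). [cite: Fulton1998, Thm. 6.2 (a)] [cite: FultonYoungTableaux1997, Appendix B §B.1 (5)–(7)] -/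
theorem polynomial_map_fiberGysin (t : ComplexPoints S) {k : ℕ} (φ : 𝒳 ⟶ 𝒳) (hφ : φ ≫ f = f) (φt : fiberOver f t ⟶ fiberOver f t)
    (hφt : φt ≫ fiberι f t = fiberι f t ≫ φ) (s : Finset ℕ) (c : ℕ → ℂ) (x : complexBetti (fiberOver f t) k) :
    (∑ m ∈ s, c m • (complexBetti.map φ (k + 2)).hom ^ m) (𝐆[hf, t, k] x) = 𝐆[hf, t, k] ((∑ m ∈ s, c m • (complexBetti.map φt k).hom ^ m) x) := by
  have hpow : ∀ (m : ℕ) (y : complexBetti (fiberOver f t) k),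
      ((complexBetti.map φ (k + 2)).hom ^ m) (𝐆[hf, t, k] y) = 𝐆[hf, t, k] (((complexBetti.map φt k).hom ^ m) y) := by
    intro m
    induction m with
    | zero => intro y; simp only [pow_zero, Module.End.one_apply]
    | succ m ih =>
      intro y
      rw [pow_succ, pow_succ, Module.End.mul_apply, Module.End.mul_apply]
      have h1 : (complexBetti.map φ (k + 2)).hom (𝐆[hf, t, k] y) = 𝐆[hf, t, k] ((complexBetti.map φt k).hom y) :=
        map_complexGysin_fiberι_eq_of_endo hf t φ hφ φt hφt (deg_fiberGysin_aux k d) y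
      rw [h1, ih]
  simp only [LinearMap.sum_apply, LinearMap.smul_apply, map_sum, map_smul, hpow]

include hf in
/-- **Polynomials in `φ^*` are algebraic self-correspondences of the total space** (`k ≤ 2(d+1)`). [cite: Fulton1998, §16.1 Prop. 16.1.1]
[cite: Kleiman1968AlgebraicCycles, Appendix to §2, proof of Thm. 2A11] -/
theorem isAlgebraicCorrespondence_polynomial_map_total {k : ℕ} (hk : k ≤ 2 * (d + 1)) (φ : 𝒳 ⟶ 𝒳) (s : Finset ℕ) (c : ℕ → ℂ) :
    IsAlgebraicCorrespondence (d + 1) (d + 1) 𝒳 𝒳 (∑ m ∈ s, c m • (complexBetti.map φ k).hom ^ m) := by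
  have h𝒳 := hf.isSmoothProjective_total
  have hφ : IsAlgebraicCorrespondence (d + 1) (d + 1) 𝒳 𝒳 (complexBetti.map φ k).hom := isAlgebraicCorrespondence_map h𝒳 h𝒳 φ hk
  have hpow : ∀ m : ℕ, IsAlgebraicCorrespondence (d + 1) (d + 1) 𝒳 𝒳 ((complexBetti.map φ k).hom ^ m) := by
    intro m
    induction m with
    | zero =>
      have h := isAlgebraicCorrespondence_map h𝒳 h𝒳 (𝟙 𝒳) hk
      rw [complexBetti.map_id] at h
      rwa [pow_zero]
    | succ m ih =>
      rw [pow_succ, Module.End.mul_eq_comp]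
      exact IsAlgebraicCorrespondence.comp h𝒳 h𝒳 h𝒳 hφ ih (by omega)
  exact IsAlgebraicCorrespondence.sum h𝒳 h𝒳 s c _ hpow 0

end Intertwiners

/-! ## §3 β from a block pattern of fibre traces -/

section Pattern

/-- **β FROM A BLOCK PATTERN OF FIBRE TRACES.** Let `f : 𝒳 ⟶ S` be a compact pencil of abelian `d`-folds, `t` a point, `k ≤ 2d`,
`I = j_t^* Hᵏ(𝒳)`. Let `G_i`, `G'_i` (`i ∈ ι`, finite) be ALGEBRAIC endomorphisms of `Hᵏ(𝒳)`, `H^{k+2}(𝒳)` intertwining endomorphisms `E_i` of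
`Hᵏ(X_t)` (`j_t^* G_i = E_i j_t^*`, `G'_i j_{t*} = j_{t*} E_i`) which are pairwise orthogonal and complete on `I`; let `π : ι → ι` be surjective and
`M_i : H^{k+2}(𝒳) → Hᵏ(𝒳)` ALGEBRAIC with every block `E_i ∘ (j_t^* M_i j_{t*}) ∘ E_{π i}` injective on `E_{π i} I`. Then β holds at `t` in degree `k`:
`M := Σ_i G_i M_i G'_{π i}` is algebraic with fibre trace `Σ_i E_i v_{M_i} E_{π i}`, injective on `I` (§1), and part XLI-a's transfer applies.
[cite: Kleiman1968AlgebraicCycles, Appendix to §2, Thm. 2A11] [cite: Fulton1998, §16.1 Prop. 16.1.1] [cite: Andre1996Motifs, §6.3 Remarque 2 (p. 33)] -/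
theorem exists_betaInverse_of_blockPattern (t : ComplexPoints S) {k : ℕ} (hk : k ≤ 2 * d) {ι : Type*} [Fintype ι] [DecidableEq ι] (i₀ : ι)
    (G : ι → complexBetti 𝒳 k →ₗ[ℂ] complexBetti 𝒳 k) (G' : ι → complexBetti 𝒳 (k + 2) →ₗ[ℂ] complexBetti 𝒳 (k + 2))
    (E : ι → complexBetti (fiberOver f t) k →ₗ[ℂ] complexBetti (fiberOver f t) k)
    (algG : ∀ i, IsAlgebraicCorrespondence (d + 1) (d + 1) 𝒳 𝒳 (G i)) (algG' : ∀ i, IsAlgebraicCorrespondence (d + 1) (d + 1) 𝒳 𝒳 (G' i))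
    (hG : ∀ i W, 𝐣[t, k] (G i W) = E i (𝐣[t, k] W)) (hG' : ∀ i x, G' i (𝐆[hf, t, k] x) = 𝐆[hf, t, k] (E i x))
    (horth : ∀ i j, i ≠ j → ∀ W, E i (E j (𝐣[t, k] W)) = 0) (hsum : ∀ W, ∑ i, E i (𝐣[t, k] W) = 𝐣[t, k] W)
    (π : ι → ι) (hπ : Function.Surjective π)
    (M : ι → complexBetti 𝒳 (k + 2) →ₗ[ℂ] complexBetti 𝒳 k) (algM : ∀ i, IsAlgebraicCorrespondence (d + 1) (d + 1) 𝒳 𝒳 (M i))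
    (hinj : ∀ i W, E i (𝐣[t, k] (M i (𝐆[hf, t, k] (E (π i) (𝐣[t, k] W))))) = 0 → E (π i) (𝐣[t, k] W) = 0) :
    ∃ T : complexBetti 𝒳 (k + 2) →ₗ[ℂ] complexBetti 𝒳 k,
      IsAlgebraicCorrespondence (d + 1) (d + 1) 𝒳 𝒳 T ∧ ∀ W, 𝐣[t, k] (T (𝐆[hf, t, k] (𝐣[t, k] W))) = 𝐣[t, k] W := by
  have h𝒳 := hf.isSmoothProjective_total
  set I : Submodule ℂ (complexBetti (fiberOver f t) k) := LinearMap.range 𝐣[t, k] with hI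
  -- the patterned correspondence
  set Mπ : complexBetti 𝒳 (k + 2) →ₗ[ℂ] complexBetti 𝒳 k := ∑ i, (1 : ℂ) • (G i ∘ₗ M i ∘ₗ G' (π i)) with hMπ
  have algMπ : IsAlgebraicCorrespondence (d + 1) (d + 1) 𝒳 𝒳 Mπ := by
    refine IsAlgebraicCorrespondence.sum h𝒳 h𝒳 Finset.univ (fun _ ↦ (1 : ℂ)) _ (fun i ↦ ?_) i₀
    exact IsAlgebraicCorrespondence.comp h𝒳 h𝒳 h𝒳 (IsAlgebraicCorrespondence.comp h𝒳 h𝒳 h𝒳 (algG' (π i)) (algM i) (by omega))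
      (algG i) (by omega)
  -- its fibre trace is the sum of blocks
  have htrace : ∀ x, 𝐣[t, k] (Mπ (𝐆[hf, t, k] x)) = ∑ i, E i ((𝐣[t, k] ∘ₗ M i ∘ₗ 𝐆[hf, t, k]) (E (π i) x)) := fun x ↦ by
    simp only [hMπ, LinearMap.sum_apply, one_smul, map_sum]
    refine Finset.sum_congr rfl fun i _ ↦ ?_
    rw [fibreTrace_conj_eq_block hf t (M i) (G i) (G' (π i)) (E i) (E (π i)) (hG i) (hG' (π i))]
    rfl
  refine exists_betaInverse_of_nondegenerate hf t hk algMπ fun W h ↦ ?_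
  rw [htrace] at h
  exact injOn_of_blockPattern I E (fun i j hij x ⟨W', hW'⟩ ↦ hW' ▸ horth i j hij W') (fun x ⟨W', hW'⟩ ↦ hW' ▸ hsum W') π hπ
    (fun i ↦ 𝐣[t, k] ∘ₗ M i ∘ₗ 𝐆[hf, t, k]) (fun i x ↦ ⟨M i (𝐆[hf, t, k] x), rfl⟩)
    (fun i x ⟨W', hW'⟩ ↦ hW' ▸ hinj i W') (𝐣[t, k] W) ⟨W, rfl⟩ h

/-- **THE SAME WITH THE PENCIL'S OWN INTERTWINERS: polynomials in an `S`-endomorphism `φ`.** For finitely many polynomials `P_i`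
(`i ∈ ι`) such that the `P_i(φ_t^*)` are pairwise orthogonal and complete on the invariant classes `j_t^* Hᵏ(𝒳)` (e.g. the Lagrange
interpolants of the distinct eigenvalues of `φ_t^*` on the invariants), a surjective `π : ι → ι`, and algebraic `M_i` whose blocks
`P_i(φ_t^*) ∘ (j_t^* M_i j_{t*}) ∘ P_{π i}(φ_t^*)` are injective on the `π i`-th piece: β holds at `t` in degree `k`. For the W₆ habitat
(`φ = N + ι` the action of the imaginary-quadratic field, pieces `ℂθ³`, `W_σ`, `W_σ̄` — lines): non-zero `(i, π i)` ENTRIES of fibre traces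
of algebraic cycles on the 14-fold, for one permutation `π`, suffice; the `(θ,θ)` entry is free (`K³ ⊗ K³`, part XLI-c), and for cycles with
real class the Weil-block entries come in complex-conjugate pairs (prose). [cite: vanGeemen1994HodgeAV, Lemma 5.2 (6) and its proof (pp. 238–240), (5.4.1)]
[cite: Kleiman1968AlgebraicCycles, Appendix to §2, Thm. 2A11] [cite: Fulton1998, Thm. 6.2 (a) and §16.1 Prop. 16.1.1] -/
theorem exists_betaInverse_of_blockPattern_of_endo (t : ComplexPoints S) {k : ℕ} (hk : k ≤ 2 * d) {ι : Type*} [Fintype ι]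
    [DecidableEq ι] (i₀ : ι) (φ : 𝒳 ⟶ 𝒳) (hφ : φ ≫ f = f) (φt : fiberOver f t ⟶ fiberOver f t) (hφt : φt ≫ fiberι f t = fiberι f t ≫ φ)
    (s : ι → Finset ℕ) (c : ι → ℕ → ℂ)
    (horth : ∀ i j, i ≠ j → ∀ W, (∑ m ∈ s i, c i m • (complexBetti.map φt k).hom ^ m)
      ((∑ m ∈ s j, c j m • (complexBetti.map φt k).hom ^ m) (𝐣[t, k] W)) = 0)
    (hsum : ∀ W, ∑ i, (∑ m ∈ s i, c i m • (complexBetti.map φt k).hom ^ m) (𝐣[t, k] W) = 𝐣[t, k] W)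
    (π : ι → ι) (hπ : Function.Surjective π)
    (M : ι → complexBetti 𝒳 (k + 2) →ₗ[ℂ] complexBetti 𝒳 k) (algM : ∀ i, IsAlgebraicCorrespondence (d + 1) (d + 1) 𝒳 𝒳 (M i))
    (hinj : ∀ i W, (∑ m ∈ s i, c i m • (complexBetti.map φt k).hom ^ m) (𝐣[t, k] (M i (𝐆[hf, t, k]
      ((∑ m ∈ s (π i), c (π i) m • (complexBetti.map φt k).hom ^ m) (𝐣[t, k] W))))) = 0 →
      (∑ m ∈ s (π i), c (π i) m • (complexBetti.map φt k).hom ^ m) (𝐣[t, k] W) = 0) :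
    ∃ T : complexBetti 𝒳 (k + 2) →ₗ[ℂ] complexBetti 𝒳 k,
      IsAlgebraicCorrespondence (d + 1) (d + 1) 𝒳 𝒳 T ∧ ∀ W, 𝐣[t, k] (T (𝐆[hf, t, k] (𝐣[t, k] W))) = 𝐣[t, k] W :=
  exists_betaInverse_of_blockPattern hf t hk i₀ (fun i ↦ ∑ m ∈ s i, c i m • (complexBetti.map φ k).hom ^ m)
    (fun i ↦ ∑ m ∈ s i, c i m • (complexBetti.map φ (k + 2)).hom ^ m) (fun i ↦ ∑ m ∈ s i, c i m • (complexBetti.map φt k).hom ^ m)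
    (fun i ↦ isAlgebraicCorrespondence_polynomial_map_total hf (by omega) φ (s i) (c i))
    (fun i ↦ isAlgebraicCorrespondence_polynomial_map_total hf (by omega) φ (s i) (c i))
    (fun i W ↦ map_fiberι_polynomial_map t φ φt hφt (s i) (c i) W)
    (fun i x ↦ polynomial_map_fiberGysin hf t φ hφ φt hφt (s i) (c i) x) horth hsum π hπ M algM hinj

/-- **Converse remark: an exact inverse has the identity pattern.** If `T` is a β-type inverse at `t` then for every splitting `E_i` of the
invariants (complete and orthogonal on `j_t^* Hᵏ(𝒳)`) the diagonal blocks `E_i (j_t^* T j_{t*}) E_i` are injective on `E_i I` (they are the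
identity there). [folklore] [cite: Andre1996Motifs, §5.1 (p. 25)] -/
theorem blockPattern_of_betaInverse (t : ComplexPoints S) {k : ℕ} {ι : Type*} [Fintype ι]
    (E : ι → complexBetti (fiberOver f t) k →ₗ[ℂ] complexBetti (fiberOver f t) k)
    (hEI : ∀ i W, ∃ W', E i (𝐣[t, k] W) = 𝐣[t, k] W')
    (horth : ∀ i j, i ≠ j → ∀ W, E i (E j (𝐣[t, k] W)) = 0) (hsum : ∀ W, ∑ i, E i (𝐣[t, k] W) = 𝐣[t, k] W)
    (T : complexBetti 𝒳 (k + 2) →ₗ[ℂ] complexBetti 𝒳 k) (hT : ∀ W, 𝐣[t, k] (T (𝐆[hf, t, k] (𝐣[t, k] W))) = 𝐣[t, k] W)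
    (i : ι) (W : complexBetti 𝒳 k) (h : E i (𝐣[t, k] (T (𝐆[hf, t, k] (E i (𝐣[t, k] W))))) = 0) : E i (𝐣[t, k] W) = 0 := by
  classical
  obtain ⟨W', hW'⟩ := hEI i W
  -- idempotence on the invariants
  have hidem : E i (E i (𝐣[t, k] W)) = E i (𝐣[t, k] W) := by
    have hs := congrArg (E i) (hsum W)
    rw [map_sum, Finset.sum_eq_single i (fun j _ hj ↦ horth i j (Ne.symm hj) W) (fun hi ↦ absurd (Finset.mem_univ i) hi)] at hs
    exact hs
  rw [hW', hT W', ← hW', hidem] at h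
  exact h

end Pattern

end Summit.HodgeConjecture.HodgeConjecture.Ring2.AbelianAll

end
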